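import Summits.Ventures.PercRepro.RankDistTight
import Mathlib.Combinatorics.Matroid.Map
import Mathlib.Combinatorics.Matroid.Constructions
import Mathlib.Combinatorics.Matroid.Rank.ENat

/-!
# PercRepro — THE 4-CYCLE WITH EARS, AS A MATROID BUILT FROM MATHLIB'S `comap` AND DUALITY (p9, gen 24)

The graph `C₄ + ears`: a 4-cycle with host edges `c_0 … c_3` and, on each host `j`, `k j` ears of length two
(triangles `{c_j, a_i, b_i}` on the edge `c_j`). Its cycle matroid is built here WITHOUT any independence-axiom proof,
from Mathlib primitives only: the 4-cycle is the uniform matroid `U_{3,4} = (U_{1,4})✶` with `U_{1,4}` the comap of the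
free matroid on one point along the constant map; gluing parallel copies of the host edges is a comap along the host
map (`par k`: `C₄` with multiplicities `1 + k j`); replacing each parallel copy by a series pair is the dual of a comap
of the dual (`ears k := ((par k)✶.comap (ser k))✶`). Everything lives on the finite type
`Gr k = Fin 4 ⊕ (Ear k × Bool)`, `Ear k = Σ j, Fin (k j)`, so the matroid is `Finite` by Mathlib's instance.
THE RANK FORMULA (`eRk_ears`): for `A ⊆ Gr k`, writing `hit A` for the ears with at least one edge in `A`, `full A` for
the ears with both, `X A = {j | c_j ∈ A}` and `X' A = X A ∪ host(full A)` (the effective core edges),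
  `ρ(A) = #hit A + min(#X' A, 3)`.
Proof: two applications of `eRk_dual_add_eRank` and two of `eRk_comap`, with the three counts
`#(Z ∖ …)` computed from the pattern of `A`. Nothing here moves any window of the crux.
-/

namespace PercRepro.RankDist

open Set Finset _root_.Matroid PercRepro.ThmH

/-- The ears: on each host `j : Fin 4`, the ears `Fin (k j)`. -/
abbrev Ear (k : Fin 4 → ℕ) := Σ j : Fin 4, Fin (k j)

/-- The ground type of `C₄ + ears`: the four host edges and the two edges of every ear. -/
abbrev Gr (k : Fin 4 → ℕ) := Fin 4 ⊕ (Ear k × Bool)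

/-- `U_{1,4}`: the comap of the free matroid on one point along the constant map (four parallel points). -/
def uOneFour : Matroid (Fin 4) := (freeOn (Set.univ : Set Unit)).comap (fun _ : Fin 4 => ())

/-- `U_{3,4}` = the cycle matroid of the 4-cycle, as the dual of `U_{1,4}`. -/
def core : Matroid (Fin 4) := uOneFour✶

/-- The host map: a host edge to itself, an ear to its host. -/
def hostE (k : Fin 4 → ℕ) : Fin 4 ⊕ Ear k → Fin 4 := Sum.elim id Sigma.fst

/-- `C₄` with `1 + k j` parallel copies of the host edge `c_j`: the comap of the core along the host map. -/
def par (k : Fin 4 → ℕ) : Matroid (Fin 4 ⊕ Ear k) := core.comap (hostE k)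

/-- The series map: a host edge to itself, an ear edge to its ear. -/
def ser (k : Fin 4 → ℕ) : Gr k → Fin 4 ⊕ Ear k := Sum.map id Prod.fst

/-- **`C₄ + ears`**: every parallel copy of `par k` replaced by a series pair — the dual of the comap of the dual. -/
def ears (k : Fin 4 → ℕ) : Matroid (Gr k) := ((par k)✶.comap (ser k))✶

variable (k : Fin 4 → ℕ)

/-! ## Ground sets -/

/-- The ground set of `U_{1,4}` is everything. -/
@[simp] lemma uOneFour_ground : uOneFour.E = Set.univ := by
  simp [uOneFour, comap_ground_eq, freeOn_ground]

/-- The ground set of the 4-cycle is everything. -/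
@[simp] lemma core_ground : core.E = Set.univ := by
  simp [core, dual_ground, uOneFour_ground]

/-- The ground set of `par k` is everything. -/
@[simp] lemma par_ground : (par k).E = Set.univ := by
  simp [par, comap_ground_eq, core_ground]

/-- The ground set of `C₄ + ears` is everything. -/
@[simp] lemma ears_ground : (ears k).E = Set.univ := by
  simp [ears, dual_ground, comap_ground_eq, par_ground]

/-- The host map is surjective. -/
lemma hostE_surjective : Function.Surjective (hostE k) := fun j => ⟨Sum.inl j, rfl⟩

/-- The series map is surjective. -/
lemma ser_surjective : Function.Surjective (ser k) := by
  rintro (j | i)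
  · exact ⟨Sum.inl j, rfl⟩
  · exact ⟨Sum.inr (i, true), rfl⟩

/-! ## The rank of the core -/

/-- `U_{1,4}` has rank `1` on every nonempty set and `0` on `∅`. -/
lemma uOneFour_eRk (V : Set (Fin 4)) : uOneFour.eRk V = if V = ∅ then 0 else 1 := by
  rw [uOneFour, eRk_comap, eRk_freeOn (Set.subset_univ _)]
  split_ifs with h
  · rw [h, Set.image_empty, Set.encard_empty]
  · have hne : V.Nonempty := Set.nonempty_iff_ne_empty.2 h
    rw [hne.image_const, Set.encard_singleton]

/-- `U_{1,4}` has rank `1`. -/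
lemma uOneFour_eRank : uOneFour.eRank = 1 := by
  rw [eRank_def, uOneFour_ground, uOneFour_eRk, if_neg Set.univ_nonempty.ne_empty]

/-- **The rank of the 4-cycle**: `ρ(Y) + 1 = [Y ≠ univ] + #Y`. -/
lemma core_eRk_add_one (Y : Set (Fin 4)) :
    core.eRk Y + 1 = (if Y = Set.univ then 0 else 1) + Y.encard := by
  have h := eRk_dual_add_eRank uOneFour Y (by rw [uOneFour_ground]; exact Set.subset_univ _)
  rw [uOneFour_eRank, uOneFour_ground, uOneFour_eRk] at h
  rw [core, h]
  congr 1
  simp only [Set.sdiff_eq_empty, Set.univ_subset_iff]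

/-- The rank of the 4-cycle, as a natural number: `min(#Y, 3)`. -/
lemma core_eRk (Y : Set (Fin 4)) : core.eRk Y = (min Y.ncard 3 : ℕ) := by
  have h := core_eRk_add_one Y
  have hfin : Y.Finite := Set.toFinite Y
  rw [← hfin.cast_ncard_eq] at h
  by_cases hY : Y = Set.univ
  · rw [if_pos hY] at h
    have hc : Y.ncard = 4 := by rw [hY, Set.ncard_univ, Nat.card_eq_fintype_card, Fintype.card_fin]
    rw [hc] at h
    have h' : core.eRk Y + 1 = ((3 : ℕ) : ℕ∞) + 1 := by
      rw [h]; norm_num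
    rw [hc]
    exact WithTop.add_right_cancel (WithTop.coe_ne_top) h'
  · rw [if_neg hY] at h
    have hle : Y.ncard ≤ 3 := by
      have h4 : Y.ncard < 4 := by
        have := Set.ncard_lt_ncard (Set.ssubset_univ_iff.2 hY) (Set.toFinite _)
        rwa [Set.ncard_univ, Nat.card_eq_fintype_card, Fintype.card_fin] at this
      omega
    rw [min_eq_left hle]
    have h' : core.eRk Y + 1 = (Y.ncard : ℕ∞) + 1 := by rw [h, add_comm]
    exact WithTop.add_right_cancel (WithTop.coe_ne_top) h'

/-- The 4-cycle has rank `3`. -/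
lemma core_eRank : core.eRank = 3 := by
  rw [eRank_def, core_ground, core_eRk, Set.ncard_univ, Nat.card_eq_fintype_card, Fintype.card_fin]
  norm_num

/-- `par k` has rank `3` (the host map is onto). -/
lemma par_eRank : (par k).eRank = 3 := by
  rw [eRank_def, par_ground, par, eRk_comap, Set.image_univ_of_surjective (hostE_surjective k),
    ← core_ground, eRk_ground, core_eRank]

/-- The ground set of `par k` has `4 + Σ_j k j` elements. -/
lemma par_ground_encard : (par k).E.encard = (4 + ∑ j, k j : ℕ) := by
  rw [par_ground, Set.encard_univ, ENat.card_eq_coe_fintype_card, Fintype.card_sum, Fintype.card_fin,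
    Fintype.card_sigma]
  simp only [Fintype.card_fin]

/-- The dual of `par k` has rank `1 + Σ_j k j`. -/
lemma par_dual_eRank : (par k)✶.eRank = (1 + ∑ j, k j : ℕ) := by
  have h := eRank_add_eRank_dual (par k)
  rw [par_eRank, par_ground_encard] at h
  have h' : (3 : ℕ∞) + (par k)✶.eRank = (3 : ℕ) + ((1 + ∑ j, k j : ℕ) : ℕ∞) := by
    rw [h, ← Nat.cast_add]; congr 1; omega
  have h3 : ((3 : ℕ) : ℕ∞) = (3 : ℕ∞) := rfl
  rw [h3] at h'
  exact WithTop.add_left_cancel (WithTop.coe_ne_top) h'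

/-- `(par k)✶.comap (ser k)` has the rank of `(par k)✶` (the series map is onto). -/
lemma parDualComap_eRank : ((par k)✶.comap (ser k)).eRank = (1 + ∑ j, k j : ℕ) := by
  rw [eRank_def, comap_ground_eq, dual_ground, par_ground, Set.preimage_univ, eRk_comap,
    Set.image_univ_of_surjective (ser_surjective k), ← par_ground k, ← dual_ground, eRk_ground,
    par_dual_eRank]

/-! ## The pattern of a set -/

/-- The host edges of `A`. -/
def earsX (A : Set (Gr k)) : Set (Fin 4) := {j | Sum.inl j ∈ A}

/-- The ears with at least one edge in `A`. -/
def earsHit (A : Set (Gr k)) : Set (Ear k) := {i | Sum.inr (i, true) ∈ A ∨ Sum.inr (i, false) ∈ A}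

/-- The ears with both edges in `A`. -/
def earsFull (A : Set (Gr k)) : Set (Ear k) := {i | Sum.inr (i, true) ∈ A ∧ Sum.inr (i, false) ∈ A}

/-- The effective core edges of `A`: the host edges in `A` and the hosts of the full ears. -/
def earsXeff (A : Set (Gr k)) : Set (Fin 4) := earsX k A ∪ Sigma.fst '' earsFull k A

/-- The ears whose `true` edge lies in `A`. -/
def earsT (A : Set (Gr k)) : Set (Ear k) := {i | Sum.inr (i, true) ∈ A}

/-- The ears whose `false` edge lies in `A`. -/
def earsF (A : Set (Gr k)) : Set (Ear k) := {i | Sum.inr (i, false) ∈ A}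

variable {k}

/-- The complement of the series image of the complement of `A`: the host edges of `A` and the full ears. -/
lemma compl_image_ser_compl (A : Set (Gr k)) :
    Set.univ \ ser k '' (Set.univ \ A) = Sum.inl '' earsX k A ∪ Sum.inr '' earsFull k A := by
  ext x
  rcases x with j | i
  · simp only [Set.mem_sdiff, Set.mem_univ, true_and, Set.mem_image, Set.mem_union, earsX, earsFull,
      Set.mem_setOf_eq, ser, not_exists, not_and]
    constructor
    · intro h
      left
      refine ⟨j, ?_, rfl⟩
      by_contra hj
      exact h (Sum.inl j) hj rfl
    · rintro (⟨j', hj', hjj⟩ | ⟨i, -, hi⟩)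
      · rintro (j'' | ⟨i, b⟩) hx hx'
        · simp only [Sum.map_inl, id_eq, Sum.inl.injEq] at hx'
          rw [Sum.inl.injEq] at hjj
          subst hx'; subst hjj; exact hx hj'
        · simp at hx'
      · simp at hi
  · simp only [Set.mem_sdiff, Set.mem_univ, true_and, Set.mem_image, Set.mem_union, earsX, earsFull,
      Set.mem_setOf_eq, ser, not_exists, not_and]
    constructor
    · intro h
      right
      refine ⟨i, ⟨?_, ?_⟩, rfl⟩
      · by_contra hi; exact h (Sum.inr (i, true)) hi rfl
      · by_contra hi; exact h (Sum.inr (i, false)) hi rfl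
    · rintro (⟨j, -, hj⟩ | ⟨i', ⟨h1, h2⟩, hii⟩)
      · simp at hj
      · rw [Sum.inr.injEq] at hii
        subst hii
        rintro (j'' | ⟨i'', b⟩) hx hx'
        · simp at hx'
        · simp only [Sum.map_inr, Sum.inr.injEq] at hx'
          subst hx'
          cases b
          · exact hx h2
          · exact hx h1

/-- The host image of the effective edges. -/
lemma image_hostE_compl (A : Set (Gr k)) :
    hostE k '' (Set.univ \ ser k '' (Set.univ \ A)) = earsXeff k A := by
  rw [compl_image_ser_compl, Set.image_union, Set.image_image, Set.image_image]
  show _ = earsX k A ∪ Sigma.fst '' earsFull k A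
  simp only [hostE, Sum.elim_inl, Sum.elim_inr, id_eq, Set.image_id']

/-- The hit ears are those with the `true` edge or the `false` edge. -/
lemma earsHit_eq_union (A : Set (Gr k)) : earsHit k A = earsT k A ∪ earsF k A := rfl

/-- The full ears are those with both edges. -/
lemma earsFull_eq_inter (A : Set (Gr k)) : earsFull k A = earsT k A ∩ earsF k A := rfl

/-- The ear edges of `A`, as a set of pairs, are the two fibres. -/
lemma earEdges_eq (A : Set (Gr k)) :
    {x : Ear k × Bool | Sum.inr x ∈ A}
      = (fun i => (i, true)) '' earsT k A ∪ (fun i => (i, false)) '' earsF k A := by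
  ext ⟨i, b⟩
  cases b <;> simp [earsT, earsF]

/-- `#A = #X + #hit + #full` (the ears with one edge count once, those with both twice). -/
lemma ncard_eq_pattern_ears (A : Set (Gr k)) :
    A.ncard = (earsX k A).ncard + (earsHit k A).ncard + (earsFull k A).ncard := by
  classical
  have hsplit : A = Sum.inl '' earsX k A ∪ Sum.inr '' {x : Ear k × Bool | Sum.inr x ∈ A} := by
    ext x
    rcases x with j | x
    · simp [earsX]
    · simp
  have hdisj : Disjoint (Sum.inl '' earsX k A) (Sum.inr '' {x : Ear k × Bool | Sum.inr x ∈ A}) := by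
    rw [Set.disjoint_left]
    rintro x ⟨j, -, rfl⟩ ⟨y, -, h⟩
    simp at h
  have hT : Function.Injective (fun i : Ear k => (i, true)) := fun _ _ h => (Prod.mk.inj h).1
  have hF : Function.Injective (fun i : Ear k => (i, false)) := fun _ _ h => (Prod.mk.inj h).1
  have hdisj2 : Disjoint ((fun i => (i, true)) '' earsT k A) ((fun i => (i, false)) '' earsF k A) := by
    rw [Set.disjoint_left]
    rintro x ⟨i, -, rfl⟩ ⟨i', -, h⟩
    simp at h
  have h1 : A.ncard = ((Sum.inl : Fin 4 → Gr k) '' earsX k A).ncard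
      + ((Sum.inr : Ear k × Bool → Gr k) '' {x : Ear k × Bool | Sum.inr x ∈ A}).ncard := by
    conv_lhs => rw [hsplit]
    exact Set.ncard_union_eq hdisj (Set.toFinite _) (Set.toFinite _)
  rw [h1, Set.ncard_image_of_injective _ Sum.inl_injective, Set.ncard_image_of_injective _ Sum.inr_injective,
    earEdges_eq, Set.ncard_union_eq hdisj2 (Set.toFinite _) (Set.toFinite _),
    Set.ncard_image_of_injective _ hT, Set.ncard_image_of_injective _ hF, earsHit_eq_union,
    earsFull_eq_inter, add_assoc, Set.ncard_union_add_ncard_inter _ _ (Set.toFinite _) (Set.toFinite _)]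

/-- The complement of the series image of `univ ∖ A` has `#X + #full` elements. -/
lemma encard_compl_image_ser_compl (A : Set (Gr k)) :
    (Set.univ \ ser k '' (Set.univ \ A)).encard = ((earsX k A).ncard + (earsFull k A).ncard : ℕ) := by
  rw [compl_image_ser_compl, Set.encard_union_eq, Sum.inl_injective.encard_image,
    Sum.inr_injective.encard_image, ← (Set.toFinite (earsX k A)).cast_ncard_eq,
    ← (Set.toFinite (earsFull k A)).cast_ncard_eq, Nat.cast_add]
  rw [Set.disjoint_left]
  rintro x ⟨j, -, rfl⟩ ⟨i, -, h⟩
  simp at h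

/-- `#Z + (#X + #full) = 4 + Σ_j k j` for `Z = ser '' (univ ∖ A)`. -/
lemma encard_image_ser_compl_add (A : Set (Gr k)) :
    (ser k '' (Set.univ \ A)).encard + ((earsX k A).ncard + (earsFull k A).ncard : ℕ) = (4 + ∑ j, k j : ℕ) := by
  have h := Set.encard_sdiff_add_encard_of_subset (Set.subset_univ (ser k '' (Set.univ \ A)))
  rw [encard_compl_image_ser_compl, Set.encard_univ, ENat.card_eq_coe_fintype_card, Fintype.card_sum,
    Fintype.card_fin, Fintype.card_sigma] at h
  rw [add_comm] at h
  simpa only [Fintype.card_fin] using h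

/-- The rank of `par k` is the rank of the host image in the core. -/
lemma par_eRk (W : Set (Fin 4 ⊕ Ear k)) : (par k).eRk W = core.eRk (hostE k '' W) := by
  rw [par, eRk_comap]

/-- **THE RANK OF `C₄ + ears`**: `ρ(A) = #hit A + min(#X' A, 3)`. -/
theorem eRk_ears (A : Set (Gr k)) :
    (ears k).eRk A = ((earsHit k A).ncard + min (earsXeff k A).ncard 3 : ℕ) := by
  have hE : ((par k)✶.comap (ser k)).E = Set.univ := by
    rw [comap_ground_eq, dual_ground, par_ground, Set.preimage_univ]
  have h1 := eRk_dual_add_eRank ((par k)✶.comap (ser k)) A (by rw [hE]; exact Set.subset_univ _)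
  rw [parDualComap_eRank, hE, eRk_comap, show ((par k)✶.comap (ser k))✶ = ears k from rfl] at h1
  have h2 := eRk_dual_add_eRank (par k) (ser k '' (Set.univ \ A)) (by rw [par_ground]; exact Set.subset_univ _)
  rw [par_eRank, par_ground, par_eRk, image_hostE_compl, core_eRk] at h2
  have h3 := encard_image_ser_compl_add A
  have h4 := ncard_eq_pattern_ears A
  -- everything is finite: cast to `ℕ`
  have hr := eRk_eq_coe_rk (ears k) (A := A) (by rw [ears_ground]; exact Set.subset_univ _)
  have hz := eRk_eq_coe_rk ((par k)✶) (A := ser k '' (Set.univ \ A))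
    (by rw [dual_ground, par_ground]; exact Set.subset_univ _)
  rw [hr, hz, (Set.toFinite A).cast_ncard_eq.symm] at h1
  rw [hz, (Set.toFinite _).cast_ncard_eq.symm] at h2
  rw [(Set.toFinite _).cast_ncard_eq.symm] at h3
  rw [hr]
  have h1' : rk (ears k) A + (1 + ∑ j, k j)
      = rk (par k)✶ (ser k '' (Set.univ \ A)) + A.ncard := by exact_mod_cast h1
  have h2' : rk (par k)✶ (ser k '' (Set.univ \ A)) + 3
      = min (earsXeff k A).ncard 3 + (ser k '' (Set.univ \ A)).ncard := by exact_mod_cast h2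
  have h3' : (ser k '' (Set.univ \ A)).ncard + ((earsX k A).ncard + (earsFull k A).ncard) = 4 + ∑ j, k j := by
    exact_mod_cast h3
  congr 1
  omega

/-- The rank of `C₄ + ears` as a natural number. -/
theorem rk_ears (A : Set (Gr k)) : rk (ears k) A = (earsHit k A).ncard + min (earsXeff k A).ncard 3 := by
  rw [← ENat.coe_inj, ← eRk_eq_coe_rk (ears k) (by rw [ears_ground]; exact Set.subset_univ _), eRk_ears]

/-- Every ear is hit by `univ`, and the effective core of `univ` is everything. -/
lemma earsHit_univ : earsHit k Set.univ = Set.univ := by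
  ext i; simp [earsHit]

/-- The effective core of `univ` is everything. -/
lemma earsXeff_univ : earsXeff k Set.univ = Set.univ := by
  apply Set.eq_univ_of_univ_subset
  intro j _
  exact Or.inl (Set.mem_univ _)

/-- **`C₄ + ears` has rank `3 + Σ_j k j`.** -/
theorem eRank_ears : (ears k).eRank = (3 + ∑ j, k j : ℕ) := by
  rw [eRank_def, ears_ground, eRk_ears, earsHit_univ, earsXeff_univ, Set.ncard_univ, Set.ncard_univ,
    Nat.card_eq_fintype_card, Nat.card_eq_fintype_card, Fintype.card_fin, Fintype.card_sigma]
  simp only [Fintype.card_fin]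
  congr 1
  omega

/-- **The ground set has `4 + 2 Σ_j k j` elements.** -/
theorem card_gr_ears : (gr (ears k)).card = 4 + 2 * ∑ j, k j := by
  rw [card_gr, ears_ground, Set.ncard_univ, Nat.card_eq_fintype_card, Fintype.card_sum, Fintype.card_prod,
    Fintype.card_sigma, Fintype.card_fin, Fintype.card_bool]
  simp only [Fintype.card_fin]
  ring

/-! ## Patterns: a set of edges as `(X, g)`, and the host types for counting -/

variable (k)

open scoped Classical in
/-- The host edges of `A`, as a finset. -/
noncomputable def patX (A : Set (Gr k)) : Finset (Fin 4) := Finset.univ.filter (fun j => Sum.inl j ∈ A)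

open scoped Classical in
/-- The ear pattern of `A`: for each ear, the set of its edges lying in `A`. -/
noncomputable def patG (A : Set (Gr k)) (i : Ear k) : Finset Bool := Finset.univ.filter (fun b => Sum.inr (i, b) ∈ A)

/-- The set of edges with a given pattern `(X, g)`. -/
def earsOf (X : Finset (Fin 4)) (g : Ear k → Finset Bool) : Set (Gr k) :=
  {x | match x with | Sum.inl j => j ∈ X | Sum.inr (i, b) => b ∈ g i}

end PercRepro.RankDist
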